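import Summits.CriticalPhenomena.PercolationContinuityZ3.Theorems.Transplant.SkelPhiConcRealised
import Summits.CriticalPhenomena.PercolationContinuityZ3.Theorems.Transplant.SkelPhiConcScheduleN
import Summits.CriticalPhenomena.PercolationContinuityZ3.Theorems.Transplant.SkelPhiCellsWeakG
import HarnessLib

/-!
# N1 (the `{±1}` node), (C) column under RULING B.15 (S1): THE REALISED ANCHORS AND THE (C) HABITAT RADII, SCHEME-GENERIC — the content of
# `SkelPhiNegRealised` (C-A6b, p286810; stated there for `cellGeomSG₂`) for ANY scheme `S : KSchA V ℕ` with the re-centring rule `anchor a v Q = a + 1`,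
# root anchor `a₀ = 0` and the root in the column of the origin cell (`root ∈ col 0`) — in particular for hp-8's small-box twin `cellGeomSG₂b` (same
# `anchor/a₀/col/root` by construction).  Over the radius schedule of record `concRadii2N P gap gap' E₀ L' off`.

builds on p205010 (kernel theorem, internal audit signed; external expert review pending) — nothing in this file uses p205010; nothing here is a
claim about the open node `SamePDropOfSkeletonNeg`.
Lane `prim-bschramm`, seat `prim-bschramm-p5` (gen 9; (C) lineage); helper file (`--supports stmt-CriticalPhenomena-4575`).
* `tgt_add_stepVec_ne_zero_of_col0` (onward targets are never the root cell), **`reach_radii_concN`** (`rQ α x = E`, `rB α v δ = E`, `ρ β x du ℓ = E − 2`,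
  `rE β x du = Frad (nQ+1) − 1`, `rM β (x+du) = Frad (nQ+1) − L'`, `nQ α x = nS α v + 1`, with `E := Erad (nQ α x)`).
[cite: KozmaNitzan2024, §4 p. 27 ((29)), Lemma 12 (pp. 23–25)]
-/

noncomputable section

open scoped Classical

namespace Summit.CriticalPhenomena.PercolationContinuityZ3.Theorems

namespace Transplant

namespace Skelφ

open Literature.Probability.Percolation Literature.Probability.LatticeModels SimpleGraph GadgetSystem Contour KNCells
open Literature.Probability.Percolation.KozmaNitzan.Cells (stepVec_apply_fst stepVec_apply_oth)
open BoxProdZ2 (Realised ConcRadiiG nQ nS gen0 Erad Frad gen0_stepVec gen0_stepVec_add_stepVec)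
open Skel (realised_of_choice l1_tgt_le_nQ nQ_tgt_eq_nS_src_succ)

variable {V : Type} [DecidableEq V] {G : SimpleGraph V} [G.LocallyFinite]

/-- **Onward targets are never the root cell** for a scheme whose root lies in the column of the origin cell: after a valid history the root is explored,
so the column of the root cell is not onward. [cite: KozmaNitzan2024, §4 p. 27 ((29))] -/
theorem tgt_add_stepVec_ne_zero_of_col0 {S : KSchA V ℕ} (hroot0 : S.Γ.root ∈ S.Γ.col 0) {h : ProbeHistory V} {e : Site 2 × MDir}
    (hV : S.Valid₂ G h e) {du : MDir} (hdu : du ∈ S.onward G h (tgt e)) : tgt e + stepVec du ≠ 0 := by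
  intro h0
  have hon := (Finset.mem_filter.1 hdu).2 _ hV.root_mem
  rw [h0] at hon
  exact hon hroot0

/-- **The (C) habitat radii at a chosen edge, scheme-generic** (re-centring `a ↦ a + 1`, root anchor `0`, `root ∈ col 0`) over
`Λ = concRadii2N P gap gap' E₀ L' off` (`20·rmax ≤ gap`, slot `off x ≤ c·‖x‖₁ + 1` with `c ≤ gap`, `1 ≤ E₀`): with `E := Erad (nQ α x)`, `rQ α x = E`,
`rB α v δ = E`, `ρ β x du ℓ = E − 2`, `rE β x du = Frad (nQ α x + 1) − 1`, `rM β (x+du) = Frad (nQ α x + 1) − L'`, `nQ α x = nS α v + 1`. [this work] -/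
theorem reach_radii_concN [Countable V] {S : KSchA V ℕ} (hanch : ∀ a v Q, S.Γ.anchor a v Q = a + 1) (h0 : S.Γ.a₀ = 0) (hroot0 : S.Γ.root ∈ S.Γ.col 0)
    {P : PCells2} {gap gap' : ℕ → ℕ} {E₀ L' : ℕ} {off : Site 2 → ℕ}
    (hgap : ∀ n, 20 * P.rmax ≤ gap n) {c : ℕ} (hgapc : ∀ n, c ≤ gap n)
    (hoff : ∀ x : Site 2, off x ≤ c * ((x 0).natAbs + (x 1).natAbs) + 1) (hE₀ : 1 ≤ E₀)
    {h : ProbeHistory V} {e : Site 2 × MDir} (hc : (S.astOf₂ G h).st.choice = some e) (hV : S.Valid₂ G h e) {du : MDir}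
    (hdu : du ∈ S.onward G h (tgt e)) :
    (concRadii2N P gap gap' E₀ L' off).rQ (S.aOf₁ G h e) (tgt e) = Erad gap gap' E₀ (nQ (S.aOf₁ G h e) (tgt e)) ∧
    (concRadii2N P gap gap' E₀ L' off).rB (S.aOf₁ G h e) e.1 e.2 = Erad gap gap' E₀ (nQ (S.aOf₁ G h e) (tgt e)) ∧
    (∀ ℓ, (concRadii2N P gap gap' E₀ L' off).ρ (S.aOf₂ G h e) (tgt e) du ℓ = Erad gap gap' E₀ (nQ (S.aOf₁ G h e) (tgt e)) - 2) ∧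
    (concRadii2N P gap gap' E₀ L' off).rE (S.aOf₂ G h e) (tgt e) du = Frad gap gap' E₀ (nQ (S.aOf₁ G h e) (tgt e) + 1) - 1 ∧
    (concRadii2N P gap gap' E₀ L' off).rM (S.aOf₂ G h e) (tgt e + stepVec du) = Frad gap gap' E₀ (nQ (S.aOf₁ G h e) (tgt e) + 1) - L' ∧
    nQ (S.aOf₁ G h e) (tgt e) = nS (S.aOf₁ G h e) e.1 + 1 := by
  have hreal : Realised (S.aOf₁ G h e) (S.aOf₂ G h e) (tgt e) := realised_of_choice hanch h0 h hc
  have hy : tgt e + stepVec du ≠ 0 := tgt_add_stepVec_ne_zero_of_col0 hroot0 hV hdu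
  obtain ⟨h1, h2, h3⟩ := hreal.sched_hyps hy
  refine ⟨?_, rfl, fun ℓ => ?_, ?_, ?_, ?_⟩
  · exact concRadii2N_rQ_eq_of_norm_le P gap' E₀ L' off hgap hgapc hE₀ (l1_tgt_le_nQ hanch h0 h hc) (hoff _)
  · rw [concRadii2N_ρ_eq P gap gap' E₀ L' off h1 h2 ℓ, hreal.nS_eq]
  · rw [concRadii2N_rE_eq P gap gap' E₀ L' off h3, hreal.nS_eq]
  · rw [concRadii2N_rM, hreal.nQ_add_stepVec hy]
  · exact nQ_tgt_eq_nS_src_succ hanch h0 h hc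

end Skelφ

end Transplant

end Summit.CriticalPhenomena.PercolationContinuityZ3.Theorems

end
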